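import Summits.Ventures.Crystal3D.Theorems.StickyWulffConstantCoaxialWallLawReflectionWordsFrame
import Summits.Ventures.Crystal3D.Theorems.StickyWulffConstantGenericWallFloorStackWalkForcedChain
import HarnessLib

/-!
# NO RETURN: a pushed stack frame never carries the bottom lattice or its basal twin
# (crux `GenericWallFloor`, stmt-Ventures-19480, kernel G; the MACHINE half of the repair of the LAYER ROWS input (J-b) after `not_hRowEndFar`
#  (p724034): what the stack walk guarantees about the frame of a c-walker's end state; machine owner 19480-p2 g14, 2026-08-29)

HONEST FRAMING. Venture `Summits/Ventures/Crystal3D` (cell `crystal3d-full`), route `route-Ventures-StickyWulffConstant`, helper for the crux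
`GenericWallFloor` (stmt-Ventures-19480) / consumer `TextureLiminfV5` (stmt-Ventures-23912).  Pure structure theorems about sound well-formed
stacks (`StackSound`, `StackWF`) — no configuration, no certificate; standard axioms; F-C1 not moved.  The algebra is ENTIRELY the reduced-word
theory of the four `{111}` reflections landed by the `CoaxialWallLaw` lane (`ReflWord.…`, `…ReflectionWords{,NormalForm,Frame}`): the 3-adic
normal form / `Γ₀ ∩ O_h = {1}` / slot-dozen rigidity.  This file only identifies a stack walker's frames as reduced words.

THE POINT.  The repaired input `HRowEndFarApart κ` (…HRowEndFarApartDefs) excludes, at an h-row END, rising certified states whose frame lattice is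
APART from the h-frame's lattice `L₁·Λ₀` and its basal twin `G₁·Λ₀` (`G₁ = twinFrame L₁ (L₁ e₃)`); the refuting witness of `HRowEndFar` carried
exactly `G₁·Λ₀`.  The LAYER ROWS c-walkers have bottoms `⟨L₁, w₁, 0⟩` / `⟨G₁, w₁, 0⟩` with `w₁` IN-PLANE; this file proves that every NON-BOTTOM
entry of such a stack has a frame lattice different from BOTH:
* `twinFrame_map_eq` — `twinFrame F (F μ) = (ℝ ∙ μ)ᗮ.reflection ≫ F`: pushing across the image of a model normal is the model reflection
  followed by the frame;
* `entries_word` — STRUCTURE: every entry of a sound well-formed stack over `⟨A, u, 0⟩` (`u` an in-plane slot) is the bottom, or has frame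
  `(ReflWord.wordIso (i :: w)).trans A` for a REDUCED word `i :: w` in the four letters whose LAST letter is inclined (`≠ 0`), its entry normal
  being `± frame (nrmVec i)` (induction up the stack: `Sound` makes each entry normal a model menu normal of the frame below, hence a letter
  by `ReflWord.exists_nrmVec_of_menu`; `StackWF` + `Link` forbid the same letter twice in a row; the first letter is inclined because
  `⟪A u, n⟫ = √(2/3)` while `⟪u, e₃⟫ = u 2 = 0`);
* `wordIso_image_fcc_ne`, `wordIso_image_fcc_ne_basal` — a reduced word with inclined last letter moves `Λ₀` and does not move it onto the basal
  twin `letterIso 0 '' Λ₀` (slot-dozen rigidity `ReflWord.image_fccSlots_eq_iff`);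
* **`frame_apart_of_stack`** — hence a NON-BOTTOM entry `e` of a sound well-formed stack over `⟨A, u, 0⟩` has
  `e.frame·Λ₀ ≠ A·Λ₀` and `e.frame·Λ₀ ≠ (twinFrame A (A e₃))·Λ₀`; **`top_bottom_or_apart`** — the top entry is the bottom entry or apart;
  `twinFrame_twinFrame_axis` — `twinFrame G₁ (G₁ e₃) = L₁`, so for the second row grain the excluded pair is the same pair.
WHAT THIS IS NOT: nothing about configurations or h-rows; the ledger′/R1′ that consume this follow; F-C1 not moved.
-/

noncomputable section

namespace Summit.Ventures.Crystal3D.Theorems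

open Finset ReflWord
open Literature.MathematicalPhysics.StatisticalMechanics (fccStacking)
open scoped InnerProductSpace

/-! ### Pushing across the image of a model normal -/

/-- **`twinFrame F (F μ)` is the model reflection across `μ` followed by `F`** (unit `μ`). -/
theorem twinFrame_map_eq (F : EuclideanSpace ℝ (Fin 3) ≃ₗᵢ[ℝ] EuclideanSpace ℝ (Fin 3)) {μ : EuclideanSpace ℝ (Fin 3)}
    (hμ : ‖μ‖ = 1) : twinFrame F (F μ) = ((ℝ ∙ μ)ᗮ.reflection).trans F := by
  have hFμ : ‖F μ‖ = 1 := by rw [LinearIsometryEquiv.norm_map, hμ]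
  refine LinearIsometryEquiv.ext fun x => ?_
  rw [twinFrame_apply F hFμ, LinearIsometryEquiv.trans_apply, reflection_unit_apply hμ, map_sub, map_smul,
    LinearIsometryEquiv.inner_map_map]

/-- The basal twin frame is the letter `0` followed by the frame: `twinFrame A (A e₃) = letterIso 0 ≫ A`. -/
theorem twinFrame_axis_eq_letter (A : EuclideanSpace ℝ (Fin 3) ≃ₗᵢ[ℝ] EuclideanSpace ℝ (Fin 3)) :
    twinFrame A (A (EuclideanSpace.single (2 : Fin 3) (1 : ℝ))) = (letterIso 0).trans A := by
  have h : ‖(EuclideanSpace.single (2 : Fin 3) (1 : ℝ))‖ = 1 := by rw [PiLp.norm_single, norm_one]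
  rw [twinFrame_map_eq A h]
  rfl

/-- **The basal twin of the basal twin is the frame**: `twinFrame G (G e₃) = A` for `G = twinFrame A (A e₃)` (so the second row grain's excluded
pair `{G·Λ₀, (twinFrame G (G e₃))·Λ₀}` is the first grain's pair). -/
theorem twinFrame_twinFrame_axis (A : EuclideanSpace ℝ (Fin 3) ≃ₗᵢ[ℝ] EuclideanSpace ℝ (Fin 3)) :
    twinFrame (twinFrame A (A (EuclideanSpace.single (2 : Fin 3) (1 : ℝ))))
      ((twinFrame A (A (EuclideanSpace.single (2 : Fin 3) (1 : ℝ)))) (EuclideanSpace.single (2 : Fin 3) (1 : ℝ))) = A := by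
  rw [twinFrame_axis_eq_letter, twinFrame_axis_eq_letter]
  refine LinearIsometryEquiv.ext fun x => ?_
  simp only [LinearIsometryEquiv.trans_apply]
  rw [letterIso_letterIso]

/-! ### Entry normals are letters -/

/-- An entry normal read in the frame BELOW is a model menu normal, hence a letter: if `e` is sound and linked to `e'` then
`e.nrm = e'.frame (± nrmVec i)` for some letter `i`. -/
theorem exists_letter_of_link {z : EuclideanSpace ℝ (Fin 3)} {e e' : WalkEntry} (hSo : e.Sound z) (hLi : e.Link e') :
    ∃ i : Fin 4, e.nrm = e'.frame (nrmVec i) ∨ e.nrm = -e'.frame (nrmVec i) := by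
  obtain ⟨-, hn, hmenu, -, -, -, -⟩ := hSo
  have hback : ∀ x, e'.frame x = e.frame x - (2 * ⟪e.frame x, e.nrm⟫_ℝ) • e.nrm := twin_symm e'.frame e.frame hn hLi.1
  have hmenu' := menu_reflect e.frame e'.frame hn hmenu hback
  set μ := e'.frame.symm e.nrm with hμ
  have hμn : ‖μ‖ = 1 := by rw [hμ, LinearIsometryEquiv.norm_map, hn]
  have hμmenu : ∀ w ∈ fccSlots, ⟪w, μ⟫_ℝ = 0 ∨ ⟪w, μ⟫_ℝ = Real.sqrt (2 / 3) ∨ ⟪w, μ⟫_ℝ = -Real.sqrt (2 / 3) := by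
    intro w hw
    have : ⟪w, μ⟫_ℝ = ⟪e'.frame w, e.nrm⟫_ℝ := by
      rw [hμ, ← LinearIsometryEquiv.inner_map_map e'.frame, LinearIsometryEquiv.apply_symm_apply]
    rw [this]; exact hmenu' w hw
  obtain ⟨i, hi⟩ := exists_nrmVec_of_menu hμn hμmenu
  refine ⟨i, ?_⟩
  have he : e.nrm = e'.frame μ := by rw [hμ, LinearIsometryEquiv.apply_symm_apply]
  rcases hi with hi | hi
  · exact Or.inl (by rw [he, hi])
  · exact Or.inr (by rw [he, hi, map_neg])

/-- With the letter of the entry normal, the frame is the letter followed by the frame below. -/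
theorem frame_eq_letter_trans {z : EuclideanSpace ℝ (Fin 3)} {e e' : WalkEntry} (hSo : e.Sound z) (hLi : e.Link e') {i : Fin 4}
    (hi : e.nrm = e'.frame (nrmVec i) ∨ e.nrm = -e'.frame (nrmVec i)) : e.frame = (letterIso i).trans e'.frame := by
  have hn : ‖e.nrm‖ = 1 := hSo.2.1
  rw [frame_eq_twinFrame_of_link hn hLi]
  rcases hi with hi | hi
  · rw [hi, twinFrame_map_eq e'.frame (norm_nrmVec i), reflection_eq_letterIso (Or.inl rfl)]
  · have h1 : -e'.frame (nrmVec i) = e'.frame (-nrmVec i) := by rw [map_neg]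
    have hn' : ‖-nrmVec i‖ = 1 := by rw [norm_neg, norm_nrmVec]
    rw [hi, h1, twinFrame_map_eq e'.frame hn', reflection_eq_letterIso (Or.inr rfl)]

/-- After the push the entry normal reads `∓` the letter in its OWN frame: `e.nrm = ± e.frame (nrmVec i)`. -/
theorem nrm_eq_frame_letter {z : EuclideanSpace ℝ (Fin 3)} {e e' : WalkEntry} (hSo : e.Sound z) (hLi : e.Link e') {i : Fin 4}
    (hi : e.nrm = e'.frame (nrmVec i) ∨ e.nrm = -e'.frame (nrmVec i)) :
    e.nrm = e.frame (nrmVec i) ∨ e.nrm = -e.frame (nrmVec i) := by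
  have hF := frame_eq_letter_trans hSo hLi hi
  have hfix : e.frame (nrmVec i) = -e'.frame (nrmVec i) := by
    rw [hF, LinearIsometryEquiv.trans_apply, letterIso_apply, real_inner_self_eq_norm_sq, norm_nrmVec, one_pow, mul_one,
      two_smul]
    simp
  rcases hi with hi | hi
  · exact Or.inr (by rw [hfix, neg_neg, hi])
  · exact Or.inl (by rw [hfix, hi])

/-- The integer normals are pairwise non-parallel (kernel-decided). -/
private theorem nrm_eq_or_neg_imp : ∀ i j : Fin 4, (nrm i = nrm j ∨ nrm i = -nrm j) → i = j := by decide

/-- Distinct letters have non-parallel normals: `nrmVec i = ± nrmVec j → i = j`. -/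
theorem letter_eq_of_nrmVec_eq {i j : Fin 4} (h : nrmVec i = nrmVec j ∨ nrmVec i = -nrmVec j) : i = j := by
  have hc : cubicCoords (nrmVec i) = cubicCoords (nrmVec j) ∨ cubicCoords (nrmVec i) = -cubicCoords (nrmVec j) := by
    rcases h with h | h
    · exact Or.inl (by rw [h])
    · exact Or.inr (by rw [h, ← neg_one_smul ℝ (nrmVec j), cubicCoords_smul, neg_one_smul])
  rw [cubicCoords_nrmVec, cubicCoords_nrmVec] at hc
  have h3 : (Real.sqrt 3)⁻¹ ≠ 0 := inv_ne_zero (Real.sqrt_ne_zero'.2 (by norm_num))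
  have hR : nrmR i = nrmR j ∨ nrmR i = -nrmR j := by
    rcases hc with hc | hc
    · exact Or.inl (smul_right_injective _ h3 hc)
    · right
      rw [← smul_neg] at hc
      exact smul_right_injective _ h3 hc
  have hZ : nrm i = nrm j ∨ nrm i = -nrm j := by
    rcases hR with hR | hR
    · left; funext a; have := congr_fun hR a; simp only [nrmR] at this; exact_mod_cast this
    · right; funext a; have := congr_fun hR a; simp only [nrmR, Pi.neg_apply] at this; exact_mod_cast this
  exact nrm_eq_or_neg_imp i j hZ

/-! ### The structure theorem: frames on a stack are reduced words -/

/-- **STRUCTURE.**  Every entry of a sound, well-formed stack with bottom `⟨A, u, 0⟩`, `u` an IN-PLANE slot, is the bottom entry or carries the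
frame `(wordIso (i :: w)).trans A` of a REDUCED word `i :: w` whose LAST letter is inclined (`≠ 0`), with entry normal `± frame (nrmVec i)`. -/
theorem entries_word {z : EuclideanSpace ℝ (Fin 3)} {A : EuclideanSpace ℝ (Fin 3) ≃ₗᵢ[ℝ] EuclideanSpace ℝ (Fin 3)}
    {u : EuclideanSpace ℝ (Fin 3)} (hu2 : u 2 = 0) :
    ∀ (rest : List WalkEntry) (e : WalkEntry), StackSound z (e :: rest) → StackWF z (e :: rest) →
      (e :: rest).getLast? = some ⟨A, u, 0⟩ →
      ∀ e₀ ∈ e :: rest, e₀ = ⟨A, u, 0⟩ ∨ ∃ (i : Fin 4) (w : List (Fin 4)), (i :: w).IsChain (· ≠ ·) ∧ (i :: w).getLast (List.cons_ne_nil i w) ≠ 0 ∧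
        e₀.frame = (wordIso (i :: w)).trans A ∧ (e₀.nrm = e₀.frame (nrmVec i) ∨ e₀.nrm = -e₀.frame (nrmVec i))
  | [], e, _, _, hlast, e₀, he₀ => by
    rw [List.mem_singleton] at he₀
    rw [List.getLast?_singleton] at hlast
    exact Or.inl (he₀.trans (Option.some.inj hlast))
  | e' :: rest', e, hS, hW, hlast, e₀, he₀ => by
    obtain ⟨hSo, hLi, hS'⟩ := hS
    obtain ⟨-, hne, hW'⟩ := (stackWF_cons_cons z e e' rest').1 hW
    have hlast' : (e' :: rest').getLast? = some ⟨A, u, 0⟩ := by rw [← hlast, List.getLast?_cons_cons]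
    have htail := entries_word hu2 rest' e' hS' hW' hlast'
    rcases List.mem_cons.1 he₀ with rfl | hmem
    swap
    · exact htail e₀ hmem
    right
    obtain ⟨i, hi⟩ := exists_letter_of_link hSo hLi
    have hF := frame_eq_letter_trans hSo hLi hi
    have hN := nrm_eq_frame_letter hSo hLi hi
    by_cases hb : e' = ⟨A, u, 0⟩
    · -- first push: the word `[i]`, `i` inclined because `⟪A u, e₀.nrm⟫ = √(2/3)` while `⟪u, e₃⟫ = 0`
      subst hb
      refine ⟨i, [], List.isChain_singleton _, ?_, ?_, hN⟩
      · intro h0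
        simp only [List.getLast_singleton] at h0
        subst h0
        have hpos : ⟪A u, e₀.nrm⟫_ℝ = Real.sqrt (2 / 3) := hLi.2
        have hzero : ⟪A u, e₀.nrm⟫_ℝ = 0 := by
          have h1 : ⟪A u, A (nrmVec 0)⟫_ℝ = 0 := by
            rw [LinearIsometryEquiv.inner_map_map, nrmVec_zero, EuclideanSpace.inner_single_right]; simp [hu2]
          rcases hi with hi | hi
          · rw [hi]; exact h1
          · rw [hi, inner_neg_right, h1, neg_zero]
        rw [hzero] at hpos
        exact absurd hpos.symm (Real.sqrt_ne_zero'.2 (by norm_num))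
      · rw [hF]; rfl
    · -- higher push: prepend the letter `i` to the word of `e'`; `i` differs from its head by `StackWF` + `Link`
      rcases htail e' List.mem_cons_self with h | ⟨i', w', hchain, hlastL, hF', hN'⟩
      · exact absurd h hb
      have hii' : i ≠ i' := by
        intro h; subst h
        -- then `e₀.nrm = ± e'.nrm`: `+` is excluded by `StackWF`, `−` by the two positivity identities
        have hneg : e₀.nrm ≠ -e'.nrm := by
          intro hc
          have h1 : ⟪e'.frame e'.dir, e₀.nrm⟫_ℝ = Real.sqrt (2 / 3) := hLi.2
          have h2 : ⟪e'.frame e'.dir, e'.nrm⟫_ℝ = Real.sqrt (2 / 3) := by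
            cases rest' with
            | nil =>
              rw [List.getLast?_singleton] at hlast'
              exact absurd (Option.some.inj hlast') hb
            | cons e'' rest'' => exact hS'.1.2.2.2.1
          rw [hc, inner_neg_right, h2] at h1
          have : 0 < Real.sqrt (2 / 3) := Real.sqrt_pos.2 (by norm_num)
          linarith
        rcases hi with hi | hi <;> rcases hN' with hN' | hN'
        · exact hne (by rw [hi, hN'])
        · exact hneg (by rw [hi, hN', neg_neg])
        · exact hneg (by rw [hi, hN'])
        · exact hne (by rw [hi, hN'])
      refine ⟨i, i' :: w', List.IsChain.cons_cons hii' hchain, ?_, ?_, hN⟩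
      · rw [List.getLast_cons (List.cons_ne_nil _ _)]; exact hlastL
      · rw [hF, hF', wordIso_cons]; rfl

/-! ### Lattice images vs slot-dozen images -/

/-- **A reduced word with inclined last letter MOVES `Λ₀`** (`Γ₀ ∩ O_h = {1}`). -/
theorem wordIso_image_fcc_ne {i : Fin 4} {w : List (Fin 4)} (hred : (i :: w).IsChain (· ≠ ·)) :
    wordIso (i :: w) '' fccStacking 1 (Real.sqrt (2 / 3)) ≠ fccStacking 1 (Real.sqrt (2 / 3)) := by
  intro h
  have h' : wordIso (i :: w) '' fccStacking 1 (Real.sqrt (2 / 3)) = wordIso [] '' fccStacking 1 (Real.sqrt (2 / 3)) := by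
    rw [h, wordIso_nil]; simp
  have hs := image_fccSlots_eq_of_image_fcc_eq _ _ h'
  have hr := (image_fccSlots_eq_iff _ _).1 hs
  rw [reduce_eq_self hred, reduce_nil] at hr
  exact List.cons_ne_nil _ _ hr

/-- **… and does not move `Λ₀` onto its BASAL TWIN** `letterIso 0 '' Λ₀` (slot-dozen rigidity: the only reduced word doing so is `[0]`). -/
theorem wordIso_image_fcc_ne_basal {i : Fin 4} {w : List (Fin 4)} (hred : (i :: w).IsChain (· ≠ ·))
    (hlast : (i :: w).getLast (List.cons_ne_nil i w) ≠ 0) :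
    wordIso (i :: w) '' fccStacking 1 (Real.sqrt (2 / 3)) ≠ letterIso 0 '' fccStacking 1 (Real.sqrt (2 / 3)) := by
  intro h
  have h' : wordIso (i :: w) '' fccStacking 1 (Real.sqrt (2 / 3)) = wordIso [0] '' fccStacking 1 (Real.sqrt (2 / 3)) := by
    rw [h, wordIso_cons, wordIso_nil]; rfl
  have hs := image_fccSlots_eq_of_image_fcc_eq _ _ h'
  have hr := (image_fccSlots_eq_iff _ _).1 hs
  rw [reduce_eq_self hred, reduce_eq_self (List.isChain_singleton _)] at hr
  have := congrArg (fun l : List (Fin 4) => l.getLast?) hr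
  simp only [List.getLast?_eq_some_getLast (List.cons_ne_nil i w), List.getLast?_singleton, Option.some.injEq] at this
  exact hlast this

/-! ### No return -/

/-- **NO RETURN — a non-bottom entry is apart from the bottom lattice and its basal twin.**  For a sound, well-formed stack `e :: rest` over the
bottom `⟨A, u, 0⟩` (`u` an in-plane slot) with `rest ≠ []`: `e.frame·Λ₀ ≠ A·Λ₀` and `e.frame·Λ₀ ≠ (twinFrame A (A e₃))·Λ₀`. -/
theorem frame_apart_of_stack {z : EuclideanSpace ℝ (Fin 3)} {A : EuclideanSpace ℝ (Fin 3) ≃ₗᵢ[ℝ] EuclideanSpace ℝ (Fin 3)}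
    {u : EuclideanSpace ℝ (Fin 3)} (hu2 : u 2 = 0) {e : WalkEntry} {rest : List WalkEntry}
    (hS : StackSound z (e :: rest)) (hW : StackWF z (e :: rest)) (hlast : (e :: rest).getLast? = some ⟨A, u, 0⟩) (hrest : rest ≠ []) :
    e.frame '' fccStacking 1 (Real.sqrt (2 / 3)) ≠ A '' fccStacking 1 (Real.sqrt (2 / 3)) ∧
      e.frame '' fccStacking 1 (Real.sqrt (2 / 3)) ≠
        (twinFrame A (A (EuclideanSpace.single (2 : Fin 3) (1 : ℝ)))) '' fccStacking 1 (Real.sqrt (2 / 3)) := by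
  rcases entries_word hu2 rest e hS hW hlast e List.mem_cons_self with hb | ⟨i, w, hred, hlastL, hF, -⟩
  · -- the top is the bottom entry only for a one-entry stack
    exfalso
    obtain ⟨e', rest', rfl⟩ := List.exists_cons_of_ne_nil hrest
    obtain ⟨hSo, hLi, hS'⟩ := hS
    have h1 : ⟪e'.frame e'.dir, e.nrm⟫_ℝ = Real.sqrt (2 / 3) := hLi.2
    rw [hb] at h1
    simp only [inner_zero_right] at h1
    exact absurd h1.symm (Real.sqrt_ne_zero'.2 (by norm_num))
  have himg : ∀ V : EuclideanSpace ℝ (Fin 3) ≃ₗᵢ[ℝ] EuclideanSpace ℝ (Fin 3),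
      ((V.trans A) '' fccStacking 1 (Real.sqrt (2 / 3))) = A '' (V '' fccStacking 1 (Real.sqrt (2 / 3))) := by
    intro V; rw [LinearIsometryEquiv.coe_trans, Set.image_comp]
  refine ⟨fun h => ?_, fun h => ?_⟩
  · rw [hF, himg] at h
    exact wordIso_image_fcc_ne hred ((Set.image_eq_image A.injective).1 h)
  · rw [hF, himg, twinFrame_axis_eq_letter, himg] at h
    exact wordIso_image_fcc_ne_basal hred hlastL ((Set.image_eq_image A.injective).1 h)

/-- **The top entry is the bottom entry or apart.**  For a sound, well-formed stack over `⟨A, u, 0⟩` (`u` in-plane): its top entry IS `⟨A, u, 0⟩`,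
or its frame lattice differs from `A·Λ₀` and from `(twinFrame A (A e₃))·Λ₀`. -/
theorem top_bottom_or_apart {z : EuclideanSpace ℝ (Fin 3)} {A : EuclideanSpace ℝ (Fin 3) ≃ₗᵢ[ℝ] EuclideanSpace ℝ (Fin 3)}
    {u : EuclideanSpace ℝ (Fin 3)} (hu2 : u 2 = 0) {e : WalkEntry} {rest : List WalkEntry}
    (hS : StackSound z (e :: rest)) (hW : StackWF z (e :: rest)) (hlast : (e :: rest).getLast? = some ⟨A, u, 0⟩) :
    e = ⟨A, u, 0⟩ ∨
      (e.frame '' fccStacking 1 (Real.sqrt (2 / 3)) ≠ A '' fccStacking 1 (Real.sqrt (2 / 3)) ∧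
        e.frame '' fccStacking 1 (Real.sqrt (2 / 3)) ≠
          (twinFrame A (A (EuclideanSpace.single (2 : Fin 3) (1 : ℝ)))) '' fccStacking 1 (Real.sqrt (2 / 3))) := by
  by_cases hrest : rest = []
  · subst hrest
    rw [List.getLast?_singleton] at hlast
    exact Or.inl (Option.some.inj hlast)
  · exact Or.inr (frame_apart_of_stack hu2 hS hW hlast hrest)

end Summit.Ventures.Crystal3D.Theorems

end
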